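import Literature.NumberTheory.PAdicHodge.BdRPlusLogLattice
import Mathlib.RingTheory.MvPowerSeries.Trunc
import HarnessLib

/-!
# Fontaine's `p`-adic logarithm modulo `Fil^k B_dR⁺` is a HOMOMORPHISM: `log((1+y)(1+y')) ≡ log(1+y) + log(1+y')`

Topic `Literature/NumberTheory/PAdicHodge`; namespaces `…PAdicHodge.LogSeries` (§1, pure algebra) and `…PAdicHodge.GaloisContinuity`
(§2–§3). THEOREMS ONLY (no definition, no instance, no named fact, no `sorry`). Sequel of `BdRPlusLogLattice` (`IsLogModFil k y L`:
the partial sums `P_M(y) = Σ_{n ≤ M} (−1)^{n+1} ι(y)ⁿ/n` converge to `L` for Fontaine's lattices `Λ(j,k) = p^j ι(𝔸_inf) + ξ^k B_dR⁺`,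
`y ∈ (p, ξ)𝔸_inf`) and of `BdRPlusLogOneAdd` §1 (`log((1+X₀)(1+X₁)) = log(1+X₀) + log(1+X₁)` in `ℚ⟦X₀,X₁⟧`, `LogSeries.log_subst_mulOneAdd`).
* §1 TRUNCATION (any commutative `ℚ`-algebra): with `G = X₀ + X₁ + X₀X₁`, `L_M = TruncatedLog.logTrunc M`, the defect
  `L_M(G) − L_M(X₀) − L_M(X₁)` has no monomial of total degree `≤ M` (`sum_C_mul_truncTotal_pow_mulOneAdd`), so it equals
  `Σ_{n ≤ M} ((−1)^{n+1}/n)·H_n` with INTEGER polynomials `H_n = Gⁿ − truncTotal_{M+1}(Gⁿ)` supported in degrees `≥ M+1`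
  (★ `aeval_logTrunc_mulOneAdd_sub`); such polynomials evaluate into `I^{M+1}` on an ideal `I` (`aeval_mem_pow_of_coeff_eq_zero`).
* §2 ESTIMATE: `H_n(y,y') ∈ (p,ξ)^{M+1} ⊆ p^{M+1−k}𝔸_inf + ξ^k𝔸_inf` and `1/n = unit·p^{−e}`, `2e ≤ n ≤ M`, so
  `P_M(y+y'+yy') − P_M(y) − P_M(y') ∈ Λ(j,k)` once `2(j+k) ≤ M` (★ `logPartialSum_mulOneAdd_sub_mem_lattice`).
* §3 ★★ `IsLogModFil.add` : `IsLogModFil k y L → IsLogModFil k y' L' → IsLogModFil k (y + y' + yy') (L + L')`; corollaries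
  `isLogModFil_zero`, `IsLogModFil.of_sub_mem` (invariance mod `ξ^k`), `IsLogModFil.pow_sub_one` (`log((1+y)ⁿ) ≡ n·log(1+y)`),
  `IsLogModFil.neg_of_mul_eq_one` (`log((1+y)⁻¹) ≡ −log(1+y)`).

Floor (H4)-1c of `Summits/…/Cruxes/StarredOptimalManinUnitFiveSeven/Lines/kato-lever-K3-B2-road.md` (crux K★ `stmt-BirchSwinnertonDyer-22226`):
the `ℚ_p`-linear structure of `X₂ = ℚ_p·log[1 + 𝔪♭] ⊂ B_dR⁺/Fil²`. Infrastructure only; BSD / K★ are not proved by any of this.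

## References
* J.-M. Fontaine, *Le corps des périodes p-adiques*, Astérisque 223 (1994), Exp. II §1.5.3–1.5.4. [FontaineAsterisque223III]
* J.-M. Fontaine, Y. Ouyang, *Theory of p-adic Galois representations*, §5.1.2, §6.1 (`log[x]`, `(B_crys⁺)^{φ=p}`). [FontaineOuyang2022]
-/

noncomputable section

open MvPowerSeries (truncTotal)

namespace Literature.NumberTheory.PAdicHodge

/-! ## §1 Truncating `log((1+X₀)(1+X₁)) = log(1+X₀) + log(1+X₁)` at total degree `M` -/
namespace LogSeries

open Finset MvPolynomial TruncatedLog

/-- For `a ∈ ℚ⟦X₀,X₁⟧` without constant term and `|d| ≤ M`, the `d`-th coefficient of `log(1 + a)` only sees the terms `aⁿ`,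
`n ≤ M` (`aⁿ` has order `≥ n`). [cite: FontaineAsterisque223III, Exp. II §1.5.4] -/
theorem coeff_log_subst_eq_sum {a : MvPowerSeries (Fin 2) ℚ} (ha : MvPowerSeries.constantCoeff a = 0)
    {d : Fin 2 →₀ ℕ} {M : ℕ} (hd : d.degree ≤ M) :
    MvPowerSeries.coeff d ((PowerSeries.log ℚ).subst a) =
      ∑ n ∈ range (M + 1), PowerSeries.coeff n (PowerSeries.log ℚ) * MvPowerSeries.coeff d (a ^ n) := by
  have hs : PowerSeries.HasSubst a := PowerSeries.HasSubst.of_constantCoeff_zero ha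
  rw [PowerSeries.coeff_subst hs]
  refine (finsum_eq_sum_of_support_subset _ ?_).trans (Finset.sum_congr rfl fun n _ => smul_eq_mul _ _)
  intro n hn
  rw [Finset.mem_coe, Finset.mem_range]
  by_contra h
  have hlt : (d.degree : ℕ∞) < (a ^ n).order := lt_of_lt_of_le (by exact_mod_cast (show d.degree < n by omega))
    (MvPowerSeries.le_order_pow_of_constantCoeff_eq_zero n ha)
  exact hn (by simp only [MvPowerSeries.coeff_of_lt_order hlt, smul_zero])

/-- ★ **The truncated functional equation, coefficientwise** (`G = X₀ + X₁ + X₀X₁ ∈ ℚ[X₀,X₁]`, `|d| ≤ M`, `c_n = coeff_n log(1+X)`):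
`Σ_{n ≤ M} c_n·coeff_d(Gⁿ) = Σ_{n ≤ M} c_n·(coeff_d(X₀ⁿ) + coeff_d(X₁ⁿ))`. [cite: FontaineAsterisque223III, Exp. II §1.5.4] -/
theorem sum_coeff_log_mul_coeff_pow_mulOneAdd {d : Fin 2 →₀ ℕ} {M : ℕ} (hd : d.degree ≤ M) :
    ∑ n ∈ range (M + 1), PowerSeries.coeff n (PowerSeries.log ℚ) *
        MvPolynomial.coeff d ((X 0 + X 1 + X 0 * X 1 : MvPolynomial (Fin 2) ℚ) ^ n) =
      ∑ n ∈ range (M + 1), PowerSeries.coeff n (PowerSeries.log ℚ) *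
        (MvPolynomial.coeff d ((X 0 : MvPolynomial (Fin 2) ℚ) ^ n) +
          MvPolynomial.coeff d ((X 1 : MvPolynomial (Fin 2) ℚ) ^ n)) := by
  have hG0 : MvPowerSeries.constantCoeff (MvPowerSeries.X 0 + MvPowerSeries.X 1 +
      MvPowerSeries.X 0 * MvPowerSeries.X 1 : MvPowerSeries (Fin 2) ℚ) = 0 := by
    simp only [map_add, map_mul, MvPowerSeries.constantCoeff_X, add_zero, mul_zero]
  have key := congrArg (MvPowerSeries.coeff d) (log_subst_mulOneAdd ℚ)
  rw [map_add, coeff_log_subst_eq_sum hG0 hd, coeff_log_subst_eq_sum (MvPowerSeries.constantCoeff_X 0) hd,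
    coeff_log_subst_eq_sum (MvPowerSeries.constantCoeff_X 1) hd, ← Finset.sum_add_distrib] at key
  have hc : ((X 0 + X 1 + X 0 * X 1 : MvPolynomial (Fin 2) ℚ) : MvPowerSeries (Fin 2) ℚ) =
      MvPowerSeries.X 0 + MvPowerSeries.X 1 + MvPowerSeries.X 0 * MvPowerSeries.X 1 := by
    simp only [MvPolynomial.coe_add, MvPolynomial.coe_mul, MvPolynomial.coe_X]
  have e1 : ∀ n : ℕ, MvPolynomial.coeff d ((X 0 + X 1 + X 0 * X 1 : MvPolynomial (Fin 2) ℚ) ^ n) =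
      MvPowerSeries.coeff d ((MvPowerSeries.X 0 + MvPowerSeries.X 1 +
        MvPowerSeries.X 0 * MvPowerSeries.X 1 : MvPowerSeries (Fin 2) ℚ) ^ n) := fun n => by
    rw [← MvPolynomial.coeff_coe, MvPolynomial.coe_pow, hc]
  have e2 : ∀ (i : Fin 2) (n : ℕ), MvPolynomial.coeff d ((X i : MvPolynomial (Fin 2) ℚ) ^ n) =
      MvPowerSeries.coeff d ((MvPowerSeries.X i : MvPowerSeries (Fin 2) ℚ) ^ n) := fun i n => by
    rw [← MvPolynomial.coeff_coe, MvPolynomial.coe_pow, MvPolynomial.coe_X]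
  simp only [e1, e2, key]
  exact Finset.sum_congr rfl fun n _ => by ring

/-- The coefficients `c_{m+1} = (−1)^m/(m+1)` of `log(1+X)` in the indexing of `TruncatedLog.logTrunc`. [folklore] -/
private theorem coeff_log_succ (m : ℕ) :
    PowerSeries.coeff (m + 1) (PowerSeries.log ℚ) = (-1 : ℚ) ^ m / (m + 1) := by
  rw [PowerSeries.coeff_log, if_neg (Nat.succ_ne_zero m), Algebra.algebraMap_self, RingHom.id_apply]
  push_cast; ring

/-- ★ **The truncated functional equation in `ℚ[X₀, X₁]`** (`G = X₀ + X₁ + X₀X₁`, `L_M = logTrunc M`):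
`Σ_{m<M} ((−1)^m/(m+1))·truncTotal_{M+1}(G^{m+1}) = L_M(X₀) + L_M(X₁)` — no mixed monomial of `L_M(G)` survives below degree
`M + 1`. [cite: FontaineAsterisque223III, Exp. II §1.5.4] -/
theorem sum_C_mul_truncTotal_pow_mulOneAdd (M : ℕ) :
    ∑ m ∈ range M, MvPolynomial.C ((-1 : ℚ) ^ m / (m + 1)) *
        truncTotal (M + 1) (((X 0 + X 1 + X 0 * X 1 : MvPolynomial (Fin 2) ℚ) ^ (m + 1) :
          MvPolynomial (Fin 2) ℚ) : MvPowerSeries (Fin 2) ℚ) =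
      Polynomial.aeval (X 0 : MvPolynomial (Fin 2) ℚ) (logTrunc M) +
        Polynomial.aeval (X 1 : MvPolynomial (Fin 2) ℚ) (logTrunc M) := by
  classical
  refine MvPolynomial.ext _ _ fun d => ?_
  rw [aeval_logTrunc, aeval_logTrunc, MvPolynomial.coeff_add, MvPolynomial.coeff_sum, MvPolynomial.coeff_sum,
    MvPolynomial.coeff_sum]
  simp only [MvPolynomial.algebraMap_eq, MvPolynomial.coeff_C_mul]
  by_cases hd : d.degree ≤ M
  · -- below degree `M + 1`: the truncations are invisible and the power-series identity applies
    have hd' : d.degree < M + 1 := Nat.lt_succ_of_le hd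
    simp only [MvPowerSeries.coeff_truncTotal _ hd', MvPolynomial.coeff_coe]
    have key := sum_coeff_log_mul_coeff_pow_mulOneAdd hd
    rw [Finset.sum_range_succ', Finset.sum_range_succ'] at key
    have h0 : PowerSeries.coeff 0 (PowerSeries.log ℚ) = 0 := by
      rw [PowerSeries.coeff_zero_eq_constantCoeff, PowerSeries.constantCoeff_log]
    simp only [h0, zero_mul, add_zero, coeff_log_succ] at key
    rw [← Finset.sum_add_distrib, key]
    exact Finset.sum_congr rfl fun m _ => by ring
  · -- from degree `M + 1` on: everything vanishes
    have hd' : M + 1 ≤ d.degree := by omega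
    have hX : ∀ (i : Fin 2), ∀ m ∈ range M, (-1 : ℚ) ^ m / (m + 1) *
        MvPolynomial.coeff d ((X i : MvPolynomial (Fin 2) ℚ) ^ (m + 1)) = 0 := by
      intro i m hm
      rw [MvPolynomial.coeff_X_pow, if_neg, mul_zero]
      rintro rfl
      rw [Finsupp.degree_single] at hd'
      exact absurd (Finset.mem_range.1 hm) (by omega)
    rw [Finset.sum_eq_zero (hX 0), Finset.sum_eq_zero (hX 1), add_zero]
    exact Finset.sum_eq_zero fun m _ => by rw [MvPowerSeries.coeff_truncTotal_eq_zero _ hd', mul_zero]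

/-- `H_n = Gⁿ − truncTotal_{M+1}(Gⁿ)` (any polynomial `q` for `G`) has no monomial of total degree `≤ M`. [folklore] -/
private theorem coeff_pow_sub_truncTotal_eq_zero {R : Type*} [CommRing R] (q : MvPolynomial (Fin 2) R) (n : ℕ) {M : ℕ}
    {d : Fin 2 →₀ ℕ} (hd : d.degree < M + 1) :
    MvPolynomial.coeff d (q ^ n - truncTotal (M + 1) ((q ^ n : MvPolynomial (Fin 2) R) : MvPowerSeries (Fin 2) R)) = 0 := by
  rw [MvPolynomial.coeff_sub, MvPowerSeries.coeff_truncTotal _ hd, MvPolynomial.coeff_coe, sub_self]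

/-- The integer polynomials `H_n = Gⁿ − truncTotal_{M+1}(Gⁿ)`, `G = X₀ + X₁ + X₀X₁ ∈ ℤ[X₀,X₁]`, base-change to the rational ones.
[folklore] -/
private theorem map_pow_sub_truncTotal_mulOneAdd (M n : ℕ) :
    MvPolynomial.map (Int.castRingHom ℚ) ((X 0 + X 1 + X 0 * X 1 : MvPolynomial (Fin 2) ℤ) ^ n -
        truncTotal (M + 1) (((X 0 + X 1 + X 0 * X 1 : MvPolynomial (Fin 2) ℤ) ^ n : MvPolynomial (Fin 2) ℤ) :
          MvPowerSeries (Fin 2) ℤ)) =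
      (X 0 + X 1 + X 0 * X 1 : MvPolynomial (Fin 2) ℚ) ^ n -
        truncTotal (M + 1) (((X 0 + X 1 + X 0 * X 1 : MvPolynomial (Fin 2) ℚ) ^ n : MvPolynomial (Fin 2) ℚ) :
          MvPowerSeries (Fin 2) ℚ) := by
  have hG : MvPolynomial.map (Int.castRingHom ℚ) ((X 0 + X 1 + X 0 * X 1 : MvPolynomial (Fin 2) ℤ) ^ n) =
      (X 0 + X 1 + X 0 * X 1 : MvPolynomial (Fin 2) ℚ) ^ n := by
    simp only [map_pow, map_add, map_mul, MvPolynomial.map_X]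
  refine MvPolynomial.ext _ _ fun d => ?_
  rw [MvPolynomial.coeff_map, MvPolynomial.coeff_sub, MvPolynomial.coeff_sub, map_sub, ← MvPolynomial.coeff_map, hG,
    MvPowerSeries.coeff_truncTotal_eq_ite, MvPowerSeries.coeff_truncTotal_eq_ite, MvPolynomial.coeff_coe,
    MvPolynomial.coeff_coe]
  split_ifs with h
  exacts [by rw [← MvPolynomial.coeff_map, hG], by rw [map_zero]]

/-- ★ **The truncated functional equation with its error term** (commutative `ℚ`-algebra `B`, `z : Fin 2 → B`, `L_M = logTrunc M`,
`G = X₀ + X₁ + X₀X₁`): `L_M(z₀ + z₁ + z₀z₁) − L_M(z₀) − L_M(z₁) = Σ_{m<M} ((−1)^m/(m+1))·H_{m+1}(z)` with the INTEGER polynomials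
`H_n = Gⁿ − truncTotal_{M+1}(Gⁿ)`, supported in total degrees `≥ M + 1`. [cite: FontaineAsterisque223III, Exp. II §1.5.4] -/
theorem aeval_logTrunc_mulOneAdd_sub {B : Type*} [CommRing B] [Algebra ℚ B] (z : Fin 2 → B) (M : ℕ) :
    Polynomial.aeval (z 0 + z 1 + z 0 * z 1) (logTrunc M) - Polynomial.aeval (z 0) (logTrunc M) -
        Polynomial.aeval (z 1) (logTrunc M) =
      ∑ m ∈ range M, algebraMap ℚ B ((-1 : ℚ) ^ m / (m + 1)) *
        MvPolynomial.aeval z ((X 0 + X 1 + X 0 * X 1 : MvPolynomial (Fin 2) ℤ) ^ (m + 1) -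
          truncTotal (M + 1) (((X 0 + X 1 + X 0 * X 1 : MvPolynomial (Fin 2) ℤ) ^ (m + 1) : MvPolynomial (Fin 2) ℤ) :
            MvPowerSeries (Fin 2) ℤ)) := by
  -- the universal case `B = ℚ[X₀, X₁]`, `z = X`
  have univ : Polynomial.aeval (X 0 + X 1 + X 0 * X 1 : MvPolynomial (Fin 2) ℚ) (logTrunc M) -
      Polynomial.aeval (X 0 : MvPolynomial (Fin 2) ℚ) (logTrunc M) - Polynomial.aeval (X 1 : MvPolynomial (Fin 2) ℚ) (logTrunc M) =
      ∑ m ∈ range M, MvPolynomial.C ((-1 : ℚ) ^ m / (m + 1)) *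
        ((X 0 + X 1 + X 0 * X 1 : MvPolynomial (Fin 2) ℚ) ^ (m + 1) -
          truncTotal (M + 1) (((X 0 + X 1 + X 0 * X 1 : MvPolynomial (Fin 2) ℚ) ^ (m + 1) : MvPolynomial (Fin 2) ℚ) :
            MvPowerSeries (Fin 2) ℚ)) := by
    rw [sub_sub, ← sum_C_mul_truncTotal_pow_mulOneAdd M, aeval_logTrunc, ← Finset.sum_sub_distrib]
    exact Finset.sum_congr rfl fun m _ => by rw [MvPolynomial.algebraMap_eq, mul_sub]
  -- specialise along `aeval z : ℚ[X₀,X₁] →ₐ[ℚ] B`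
  have h := congrArg (MvPolynomial.aeval z) univ
  rw [map_sub, map_sub, ← Polynomial.aeval_algHom_apply, ← Polynomial.aeval_algHom_apply,
    ← Polynomial.aeval_algHom_apply, map_sum] at h
  simp only [map_add, map_mul, MvPolynomial.aeval_X, MvPolynomial.aeval_C] at h
  rw [h]
  exact Finset.sum_congr rfl fun m _ => by
    rw [← map_pow_sub_truncTotal_mulOneAdd M (m + 1), ← algebraMap_int_eq, MvPolynomial.aeval_map_algebraMap]

/-- **An integer polynomial supported in total degrees `≥ N` evaluates into `I^N`** at elements of an ideal `I`.
[folklore] -/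
private theorem aeval_mem_pow_of_coeff_eq_zero {σ R : Type*} [CommRing R] {I : Ideal R} {y : σ → R} (hy : ∀ i, y i ∈ I)
    {q : MvPolynomial σ ℤ} {N : ℕ} (hq : ∀ d : σ →₀ ℕ, d.degree < N → MvPolynomial.coeff d q = 0) :
    MvPolynomial.aeval y q ∈ I ^ N := by
  rw [MvPolynomial.as_sum q, map_sum]
  refine Ideal.sum_mem _ fun d hd => ?_
  have hN : N ≤ d.degree := not_lt.1 fun h => (MvPolynomial.mem_support_iff.1 hd) (hq d h)
  rw [MvPolynomial.aeval_monomial]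
  refine Ideal.mul_mem_left _ _ (Ideal.pow_le_pow_right hN ?_)
  rw [Finsupp.prod, Finsupp.degree_apply, ← Finset.prod_pow_eq_pow_sum]
  exact Ideal.prod_mem_prod fun i _ => Ideal.pow_mem_pow (hy i) _

end LogSeries
/-! ## §2 The `p`-adic estimate in `B_dR⁺`: the defect of `P_M` lies in `Λ(j, k)` for `2(j+k) ≤ M` -/
namespace GaloisContinuity

open ValuativeRel Field Ideal WittVector Finset TruncatedLog
open Literature.NumberTheory.GaloisRepresentations Literature.NumberTheory.GaloisRepresentations.IsNonarchimedeanLocalField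

variable {F : Type} [Field F] [ValuativeRel F] [TopologicalSpace F] [IsNonarchimedeanLocalField F]
  [CharZero F] {p : ℕ} [Fact p.Prime] [Fact (¬ IsUnit (p : integerC F))]
  [IsAdicComplete (Ideal.span {(p : integerC F)}) (integerC F)]

omit [CharZero F] in
/-- `Λ(N, k)` is closed under finite sums. [cite: FontaineAsterisque223III, Exp. II §1.5.3] -/
theorem lattice_sum {ι : Type*} (s : Finset ι) {f : ι → BDeRhamPlus (integerC F) p} {N k : ℕ}
    (h : ∀ i ∈ s, ∃ (a : Ainf (p := p) F) (w : BDeRhamPlus (integerC F) p),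
      f i = ainfToBdR ((p : Ainf (p := p) F) ^ N * a) + xiBdR ^ k * w) :
    ∃ (a : Ainf (p := p) F) (w : BDeRhamPlus (integerC F) p),
      ∑ i ∈ s, f i = ainfToBdR ((p : Ainf (p := p) F) ^ N * a) + xiBdR ^ k * w := by
  classical
  induction s using Finset.induction_on with
  | empty => exact ⟨0, 0, by simp⟩
  | insert i s hi ih =>
    obtain ⟨a, w, ha⟩ := h i (Finset.mem_insert_self _ _)
    obtain ⟨b, v, hb⟩ := ih fun j hj => h j (Finset.mem_insert_of_mem hj)
    exact ⟨a + b, w + v, by rw [Finset.sum_insert hi]; exact lattice_add ha hb⟩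

omit [CharZero F] [IsAdicComplete (Ideal.span {(p : integerC F)}) (integerC F)] in
/-- `(p, ξ)^N ⊆ p^{N−k} 𝔸_inf + ξ^k 𝔸_inf` on elements (`k ≤ N`). [cite: FontaineAsterisque223III, Exp. II §1.3] -/
theorem exists_eq_of_mem_span_p_xi_pow {w : Ainf (p := p) F} {N k : ℕ} (hk : k ≤ N)
    (hw : w ∈ Ideal.span {(p : Ainf (p := p) F), xi} ^ N) :
    ∃ b c : Ainf (p := p) F, w = (p : Ainf (p := p) F) ^ (N - k) * b + xi ^ k * c := by
  have h1 : w ∈ Ideal.span {(p : Ainf (p := p) F), xi} ^ ((N - k) + k) := by rwa [Nat.sub_add_cancel hk]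
  obtain ⟨u, hu, v, hv, huv⟩ := Submodule.mem_sup.1 (span_p_xi_pow_le (N - k) k h1)
  obtain ⟨⟨b, hb⟩, ⟨c, hc⟩⟩ := And.intro (Ideal.mem_span_singleton'.1 hu) (Ideal.mem_span_singleton'.1 hv)
  exact ⟨b, c, by rw [← huv, ← hb, ← hc]; ring⟩

/-- `v_q(n) ≤ n/2` for `q ≥ 2`, in the form `q^e ∣ n ≠ 0 ⇒ e + e ≤ n`. [folklore] -/
private theorem add_self_le_of_pow_dvd {q e n : ℕ} (hq : 2 ≤ q) (hn : n ≠ 0) (h : q ^ e ∣ n) : e + e ≤ n := by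
  have h2 : ∀ m : ℕ, m + m ≤ 2 ^ m := fun m => by
    induction m with
    | zero => simp
    | succ m ih => have hm : 1 ≤ 2 ^ m := Nat.one_le_two_pow; rw [pow_succ]; omega
  exact (h2 e).trans ((Nat.pow_le_pow_left hq e).trans (Nat.le_of_dvd (Nat.pos_of_ne_zero hn) h))

omit [CharZero F] in
/-- **Coefficient estimate**: for `w ∈ (p, ξ)^{M+1}`, `m < M`, `2(j + k) ≤ M`: `((−1)^m/(m+1))·ι(w) ∈ Λ(j, k)` (the denominator
`m + 1 = p^e n'` costs `p^{−e}`, `2e ≤ m + 1 ≤ M`; `(p,ξ)^{M+1} ⊆ p^{M+1−k}𝔸_inf + ξ^k𝔸_inf`). [cite: FontaineAsterisque223III, Exp. II §1.5.3] -/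
theorem algebraMap_coeff_mul_ainfToBdR_mem_lattice {j k M m : ℕ} (hM : 2 * (j + k) ≤ M) (hm : m < M)
    {w : Ainf (p := p) F} (hw : w ∈ Ideal.span {(p : Ainf (p := p) F), xi} ^ (M + 1)) :
    ∃ (a : Ainf (p := p) F) (v : BDeRhamPlus (integerC F) p),
      algebraMap ℚ (BDeRhamPlus (integerC F) p) ((-1 : ℚ) ^ m / (m + 1)) * ainfToBdR w =
        ainfToBdR ((p : Ainf (p := p) F) ^ j * a) + xiBdR ^ k * v := by
  -- `m + 1 = p^e n'`, `p ∤ n'`, `e + e ≤ m + 1`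
  obtain ⟨e, n', hn', hne⟩ := Nat.exists_eq_pow_mul_and_not_dvd (Nat.add_one_ne_zero m) p (Fact.out : p.Prime).one_lt.ne'
  have he : e + e ≤ m + 1 := add_self_le_of_pow_dvd (Fact.out : p.Prime).two_le (Nat.add_one_ne_zero m) ⟨n', hne⟩
  obtain ⟨b, c, hbc⟩ := exists_eq_of_mem_span_p_xi_pow (show k ≤ M + 1 by omega) hw
  obtain ⟨v, hv⟩ := isUnit_natCast_padicInt_of_not_dvd (p := p) hn'
  -- the coefficient `(−1)^m/(m+1) · p^{M+1−k} = g · p^{M+1−k−e}` with `g = (−1)^m v⁻¹ ∈ ℤ_p`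
  set g : ℤ_[p] := (-1) ^ m * ↑v⁻¹ with hg
  have hp0 : (p : ℚ_[p]) ≠ 0 := Nat.cast_ne_zero.2 (Fact.out : p.Prime).ne_zero
  have hcoef : algebraMap ℚ ℚ_[p] ((-1 : ℚ) ^ m / (m + 1)) * (p : ℚ_[p]) ^ (M + 1 - k) =
      (g : ℚ_[p]) * (p : ℚ_[p]) ^ (M + 1 - k - e) := by
    have hvv : ((v : ℤ_[p]) : ℚ_[p]) * ((↑v⁻¹ : ℤ_[p]) : ℚ_[p]) = 1 := by
      rw [← PadicInt.coe_mul, Units.mul_inv, PadicInt.coe_one]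
    have hA0 : ((v : ℤ_[p]) : ℚ_[p]) ≠ 0 := fun h0 => by rw [h0, zero_mul] at hvv; exact zero_ne_one hvv
    have hB : (((v⁻¹ : ℤ_[p]ˣ) : ℤ_[p]) : ℚ_[p]) = (((v : ℤ_[p]) : ℚ_[p]))⁻¹ := eq_inv_of_mul_eq_one_right hvv
    have hsplit : (p : ℚ_[p]) ^ (M + 1 - k) = (p : ℚ_[p]) ^ e * (p : ℚ_[p]) ^ (M + 1 - k - e) := by
      rw [← pow_add]; congr 1; omega
    have hn1 : ((m : ℚ_[p]) + 1) = (p : ℚ_[p]) ^ e * ((v : ℤ_[p]) : ℚ_[p]) := by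
      rw [hv, PadicInt.coe_natCast]; exact_mod_cast hne
    rw [map_div₀, map_pow, map_neg, map_one, map_add, map_natCast, map_one, hsplit, hg, PadicInt.coe_mul,
      PadicInt.coe_pow, PadicInt.coe_neg, PadicInt.coe_one, hB, hn1]
    field_simp
  have hj : j ≤ M + 1 - k - e := by omega
  refine lattice_mono hj le_rfl (a := zpToAinf g * b)
    (w := algebraMap ℚ (BDeRhamPlus (integerC F) p) ((-1 : ℚ) ^ m / (m + 1)) * ainfToBdR c) ?_
  have hq : algebraMap ℚ (BDeRhamPlus (integerC F) p) ((-1 : ℚ) ^ m / (m + 1)) *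
      (p : BDeRhamPlus (integerC F) p) ^ (M + 1 - k) =
      ainfToBdR ((p : Ainf (p := p) F) ^ (M + 1 - k - e) * zpToAinf g) := by
    rw [algebraMap_rat_bDeRhamPlus, ← map_natCast (qpToBdR (F := F) (p := p)) p, ← map_pow, ← map_mul, hcoef, map_mul,
      map_pow, map_natCast, qpToBdR_coe]
    simp only [map_mul, map_pow, map_natCast]
    ring
  rw [hbc, map_add, map_mul, map_mul, map_pow, map_natCast, map_pow, ainfToBdR_xi, mul_add, ← mul_assoc, hq]
  simp only [map_mul, map_pow, map_natCast]
  ring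

/-- `y, y' ∈ I` — the two coordinates of `![y, y']` lie in `I`. [folklore] -/
private theorem vecCons_mem {R : Type*} [CommRing R] {I : Ideal R} {y y' : R} (hy : y ∈ I) (hy' : y' ∈ I) :
    ∀ i : Fin 2, (![y, y'] : Fin 2 → R) i ∈ I := by
  intro i
  fin_cases i
  exacts [hy, hy']

omit [CharZero F] in
/-- ★ **The defect of the partial sums is `p`-adically small modulo `Fil^k`**: for `y, y' ∈ (p, ξ)𝔸_inf` and `2(j + k) ≤ M`,
`P_M(y + y' + yy') − P_M(y) − P_M(y') ∈ Λ(j, k) = p^j ι(𝔸_inf) + ξ^k B_dR⁺`. [cite: FontaineAsterisque223III, Exp. II §1.5.4] -/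
theorem logPartialSum_mulOneAdd_sub_mem_lattice {y y' : Ainf (p := p) F}
    (hy : y ∈ Ideal.span {(p : Ainf (p := p) F), xi}) (hy' : y' ∈ Ideal.span {(p : Ainf (p := p) F), xi})
    {j k M : ℕ} (hM : 2 * (j + k) ≤ M) :
    ∃ (a : Ainf (p := p) F) (w : BDeRhamPlus (integerC F) p),
      logPartialSum (y + y' + y * y') M - logPartialSum y M - logPartialSum y' M =
        ainfToBdR ((p : Ainf (p := p) F) ^ j * a) + xiBdR ^ k * w := by
  set z : Fin 2 → BDeRhamPlus (integerC F) p := fun i => ainfToBdR ((![y, y'] : Fin 2 → Ainf (p := p) F) i) with hz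
  have h0 : z 0 = ainfToBdR y := rfl
  have h1 : z 1 = ainfToBdR y' := rfl
  rw [logPartialSum_eq_aeval_logTrunc, logPartialSum_eq_aeval_logTrunc, logPartialSum_eq_aeval_logTrunc, map_add, map_add,
    map_mul, ← h0, ← h1, LogSeries.aeval_logTrunc_mulOneAdd_sub z M]
  refine lattice_sum _ fun m hm => ?_
  -- `H_{m+1}(ι y, ι y') = ι(H_{m+1}(y, y'))` with `H_{m+1}(y, y') ∈ (p, ξ)^{M+1}`
  have hH := MvPolynomial.comp_aeval_apply (ainfToBdR (F := F) (p := p)).toIntAlgHom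
    (f := (![y, y'] : Fin 2 → Ainf (p := p) F))
    ((MvPolynomial.X 0 + MvPolynomial.X 1 + MvPolynomial.X 0 * MvPolynomial.X 1 : MvPolynomial (Fin 2) ℤ) ^ (m + 1) -
      truncTotal (M + 1) (((MvPolynomial.X 0 + MvPolynomial.X 1 + MvPolynomial.X 0 * MvPolynomial.X 1 :
        MvPolynomial (Fin 2) ℤ) ^ (m + 1) : MvPolynomial (Fin 2) ℤ) : MvPowerSeries (Fin 2) ℤ))
  rw [show (fun i => (ainfToBdR (F := F) (p := p)).toIntAlgHom ((![y, y'] : Fin 2 → Ainf (p := p) F) i)) = z from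
    funext fun i => rfl] at hH
  rw [← hH]
  exact algebraMap_coeff_mul_ainfToBdR_mem_lattice hM (Finset.mem_range.1 hm)
    (LogSeries.aeval_mem_pow_of_coeff_eq_zero (vecCons_mem hy hy')
      fun d hd => LogSeries.coeff_pow_sub_truncTotal_eq_zero _ _ hd)

/-! ## §3 `IsLogModFil` is additive: `log((1+y)(1+y')) ≡ log(1+y) + log(1+y') (mod Fil^k)` -/

omit [CharZero F] in
/-- ★★ **Fontaine's `p`-adic logarithm modulo `Fil^k` is a homomorphism.** If `L` is a logarithm of `1 + y` and `L'` one of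
`1 + y'` modulo `Fil^k B_dR⁺` (`y, y' ∈ (p, ξ)𝔸_inf`), then `L + L'` is a logarithm of `(1 + y)(1 + y') = 1 + (y + y' + yy')`
modulo `Fil^k`. [cite: FontaineAsterisque223III, Exp. II §1.5.4] [cite: FontaineOuyang2022, §6.1] -/
theorem IsLogModFil.add {k : ℕ} {y y' : Ainf (p := p) F} (hy : y ∈ Ideal.span {(p : Ainf (p := p) F), xi})
    (hy' : y' ∈ Ideal.span {(p : Ainf (p := p) F), xi}) {L L' : BDeRhamPlus (integerC F) p}
    (hL : IsLogModFil k y L) (hL' : IsLogModFil k y' L') : IsLogModFil k (y + y' + y * y') (L + L') := by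
  intro j
  obtain ⟨M₀, h⟩ := hL j
  obtain ⟨M₀', h'⟩ := hL' j
  refine ⟨max (max M₀ M₀') (2 * (j + k)), fun M hM => ?_⟩
  obtain ⟨a, w, h1⟩ := h M ((le_max_left _ _).trans ((le_max_left _ _).trans hM))
  obtain ⟨a', w', h2⟩ := h' M ((le_max_right _ _).trans ((le_max_left _ _).trans hM))
  obtain ⟨a'', w'', h3⟩ := logPartialSum_mulOneAdd_sub_mem_lattice hy hy' (j := j) (k := k) ((le_max_right _ _).trans hM)
  refine ⟨a + a' - a'', w + w' - w'', ?_⟩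
  have e : L + L' - logPartialSum (y + y' + y * y') M = (L - logPartialSum y M) + (L' - logPartialSum y' M) -
      (logPartialSum (y + y' + y * y') M - logPartialSum y M - logPartialSum y' M) := by ring
  rw [e]
  exact lattice_sub (lattice_add h1 h2) h3

omit [CharZero F] in
/-- `P_M(0) = 0`. [cite: FontaineAsterisque223III, Exp. II §1.5.4] -/
theorem logPartialSum_zero (M : ℕ) : logPartialSum (0 : Ainf (p := p) F) M = 0 := by
  rw [logPartialSum_eq_aeval_logTrunc, map_zero, aeval_logTrunc]
  exact Finset.sum_eq_zero fun m _ => by rw [zero_pow (Nat.succ_ne_zero m), mul_zero]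

omit [CharZero F] in
/-- `0` is a logarithm of `1 + 0` modulo every `Fil^k` (`P_M(0) = 0`). [cite: FontaineAsterisque223III, Exp. II §1.5.4] -/
theorem isLogModFil_zero (k : ℕ) : IsLogModFil k (0 : Ainf (p := p) F) 0 := by
  intro j
  exact ⟨0, fun M _ => ⟨0, 0, by rw [logPartialSum_zero, sub_zero, mul_zero, map_zero, mul_zero, add_zero]⟩⟩

omit [CharZero F] in
/-- **Invariance modulo `Fil^k`**: if `L` is a logarithm of `1 + y` modulo `Fil^k` and `L' ≡ L (mod ξ^k B_dR⁺)`, so is `L'`.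
[cite: FontaineAsterisque223III, Exp. II §1.5.3] -/
theorem IsLogModFil.of_sub_mem {k : ℕ} {y : Ainf (p := p) F} {L L' : BDeRhamPlus (integerC F) p} (hL : IsLogModFil k y L)
    (h : L' - L ∈ Ideal.span {(xiBdR : BDeRhamPlus (integerC F) p) ^ k}) : IsLogModFil k y L' := by
  obtain ⟨c, hc⟩ := Ideal.mem_span_singleton'.1 h
  intro j
  obtain ⟨M₀, hM₀⟩ := hL j
  refine ⟨M₀, fun M hM => ?_⟩
  obtain ⟨a, w, h1⟩ := hM₀ M hM
  refine ⟨a, w + c, ?_⟩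
  have e : L' - logPartialSum y M = (L - logPartialSum y M) + (L' - L) := by ring
  rw [e, h1, ← hc]; ring

/-- `(1 + y)ⁿ − 1 ∈ I` for `y ∈ I`. [folklore] -/
private theorem one_add_pow_sub_one_mem {R : Type*} [CommRing R] {I : Ideal R} {y : R} (hy : y ∈ I) (n : ℕ) :
    (1 + y) ^ n - 1 ∈ I := by
  induction n with
  | zero => rw [pow_zero, sub_self]; exact Submodule.zero_mem _
  | succ n ih =>
    have e : (1 + y) ^ (n + 1) - 1 = ((1 + y) ^ n - 1) + y + ((1 + y) ^ n - 1) * y := by ring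
    rw [e]
    exact add_mem (add_mem ih hy) (Ideal.mul_mem_right _ _ ih)

omit [CharZero F] in
/-- ★ **Powers**: if `L` is a logarithm of `1 + y` modulo `Fil^k` then `n • L` is one of `(1 + y)ⁿ = 1 + ((1+y)ⁿ − 1)`.
[cite: FontaineAsterisque223III, Exp. II §1.5.4] -/
theorem IsLogModFil.pow_sub_one {k : ℕ} {y : Ainf (p := p) F} (hy : y ∈ Ideal.span {(p : Ainf (p := p) F), xi})
    {L : BDeRhamPlus (integerC F) p} (hL : IsLogModFil k y L) (n : ℕ) : IsLogModFil k ((1 + y) ^ n - 1) (n • L) := by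
  induction n with
  | zero => rw [pow_zero, sub_self, zero_smul]; exact isLogModFil_zero k
  | succ n ih =>
    have e : (1 + y) ^ (n + 1) - 1 = ((1 + y) ^ n - 1) + y + ((1 + y) ^ n - 1) * y := by ring
    rw [e, add_smul, one_smul]
    exact ih.add (one_add_pow_sub_one_mem hy n) hy hL

/-- ★ **Inverses**: if `(1 + y)(1 + y') = 1` (`y, y' ∈ (p, ξ)`) and `L` is a logarithm of `1 + y` modulo `Fil^k`, then `−L` is a
logarithm of `1 + y'`. [cite: FontaineAsterisque223III, Exp. II §1.5.4] -/
theorem IsLogModFil.neg_of_mul_eq_one {k : ℕ} {y y' : Ainf (p := p) F} (hy : y ∈ Ideal.span {(p : Ainf (p := p) F), xi})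
    (hy' : y' ∈ Ideal.span {(p : Ainf (p := p) F), xi}) (hyy' : (1 + y) * (1 + y') = 1)
    {L : BDeRhamPlus (integerC F) p} (hL : IsLogModFil k y L) : IsLogModFil k y' (-L) := by
  obtain ⟨L', hL'⟩ := exists_isLogModFil hy' k
  have h0 : y + y' + y * y' = 0 := by linear_combination hyy'
  have hsum : IsLogModFil k (0 : Ainf (p := p) F) (L + L') := h0 ▸ hL.add hy hy' hL'
  have hmem := hsum.sub_mem_span_xiBdR_pow (isLogModFil_zero k)
  exact hL'.of_sub_mem (by rw [show -L - L' = -((L + L') - 0) by ring]; exact neg_mem hmem)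

end GaloisContinuity
end Literature.NumberTheory.PAdicHodge
end
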